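import Summits.PneNP.PneNP.Theorems.ChebyshevTracialDesignScalarTiltFixedDirection
import HarnessLib

/-!
# Cell pnp-psdrank, route `ChebyshevTracialDesign`: THE PER-CUT PINNED-PARTNER FORM OF (PC) FOR EDGE-TYPE FIELDS — the corrected smallest open
# instance `v_M(p) = h(M)·ν(p, π_M p)` is, up to `n⁴γ`, cube-positivity of the virtual pinned-partner densities of `h²` AT THE CUT
# (brick 171; crux `TracialDecayExp20`, stmt-PneNP-19878)

Brick 171 (prover g33; MEMO-36 §2(c)–(d)), the per-CUT dual of brick 102 §2–§4 (which is per MATCHING, for a mask). Notation: `x_p = 1[p ∈ U]`, `π_M` the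
partner map, `C_v(U) = Σ_p v_p x_p x_{π_M p}`. After bricks 170/170b/170c the open residue of the per-cut statement (PC) on the M-dependence axis needs
directions that ROTATE with `M`; the smallest such class is the EDGE-TYPE field `v_M(p) = h(M)·ν(p, π_M p)` — a FIXED (signed, not necessarily symmetric)
pair weighting `ν : [n]² → [−1,1]` transported by the matching, under an arbitrary scalar tilt `|h(M)| ≤ 1`. For it, per cut `U`,
`C_{v_M}(U) = h(M)·Σ_{p∈U, π_Mp∈U} ν(p, π_M p)` and, re-indexing partners as free vertices (102 `sum_ite_eq_partner`),
  `Σ_M W(U,M) C_{v_M}(U)² = Σ_{p,p',q,q'} ν(p,p')ν(q,q')·x_px_{p'}x_qx_{q'}·R_U(p,p';q,q')`,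
  `R_U(p,p';q,q') := Σ_M W(U,M)·h(M)²·1[π_M p = p']·1[π_M q = q']`
— the PINNED-PARTNER TILTED DESIGN VALUES AT THE CUT (`h ≡ 1`, `W = levelWeight`: minus the virtual pinned densities `κ₁/Z`, `κ₂/Z` of the level-1
pseudo-moment matrix, MEMO-36 §2(d)). This file proves, for ANY weight `W` whose 0/1 rectangle sums are `≤ γ`:
* §1 `edgeField_containment_eq`, `edgeField_containment_sq_eq`, **`perCut_edgeField_eq_sum_pinned`** (the identity above);
* §2 **`sum_posPart_perCut_pinned_le`**: `Σ_U Σ_{p,p',q,q'} x_px_{p'}x_qx_{q'}·(R_U(p,p';q,q'))₊ ≤ n⁴·γ` — the per-cut pinned-partner values are virtually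
  nonpositive ENTRYWISE on average over the cuts (each entry's positive part over the cuts is a [0,1]-weighted rectangle, brick 170's
  `sum_posPart_cut_mul_le_of_rectangles`);
* §3 **`perCut_edgeField_sub_negPart_abs_le`** (per cut: `|Σ_M W C_{v_M}² − Σ νν·x⁴·min(R_U,0)| ≤ Σ x⁴(R_U)₊` for `|ν| ≤ 1`),
  **`sum_perCut_edgeField_sub_negPart_abs_le`** (`Σ_U |…| ≤ n⁴γ`), **`sum_posPart_perCut_edgeField_le_negPart`** / **`…_negPart_le_edgeField`**:
  (PC) on the edge-type field `h·ν∘π` ⟺ (two-sided, up to `n⁴γ`) «`Σ_U (Σ_{p,p',q,q'} ν(p,p')ν(q,q')·x⁴·(−min(R_U,0)))₋` is small», i.e. the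
  entrywise-NONNEGATIVE arrays `N_U := −min(R_U, 0)` (virtual pinned-partner densities of `h²` around the cut `U`) are positive semidefinite in the
  direction `ν ⊗ ν`, on average over cuts — a SECOND-ORDER NTF per cut (for sign-coherent `ν ≥ 0` it is automatic; for vertex-type
  `ν(p,p') = u_p` it is brick 170);
* §4 design corollaries, UNCONDITIONAL for the crux's balanced Chebyshev designs (`γ = 20e^{−a·dq n}`, `rectangleDecayExp_all_holds`):
  **`perCut_pinned_posPart_decay`**, **`perCut_edgeField_negPart_reduction`**.
WHAT THIS FILE DOES NOT DO: bound the negative-part form for any spread `h` (that is (PC-ν), MEMO-36 §2(c), OPEN); anything on `TracialDecayExp20`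
itself, psd rank of P_PM(K_n), or P vs NP. [cite: Rothvoss2017, §2 and Lemma 7 (PDF pp. 6–8)] [cite: Grigoriev2001, Lemma 1.4 (PDF p. 8)]
[cite: GriblingDelaatLaurent2019, §5] [cite: KeevashLifshitz2023, Thm. 1.8]
Stature: support/instrument (kernel lane, no defs, axioms standard). Supports stmt-PneNP-19878.
-/

set_option linter.dupNamespace false -- `Summit.PneNP.PneNP.…`: summit = sub-problem (D-0017)

noncomputable section

namespace Summit.PneNP.PneNP.Theorems.ChebyshevTracialDesignPerCutPinnedPartners

open Finset Literature.Barriers.PneNP Literature.Combinatorics.Optimization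
open Summit.PneNP.PneNP.Theorems.ChebyshevTracialDesignPairContainmentEntrywise
  (sum_ite_eq_partner posPart_sum_le posPart_le_posPart_add_abs rectBound_nonneg)
open Summit.PneNP.PneNP.Theorems.ChebyshevTracialDesignScalarTiltFixedDirection (sum_posPart_cut_mul_le_of_rectangles)
open Summit.PneNP.PneNP.Theorems.ChebyshevTracialDesignUnconditionalRungs (rectangleDecayExp_all_holds)

variable {n : ℕ}

/-! ### §1 The per-cut value of an edge-type field as a quadratic form in `ν ⊗ ν` against pinned-partner design values -/

/-- Partner re-indexing of the containment form of an edge-type field: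
`Σ_p h·ν(p,π_Mp)·x_p x_{π_Mp} = h·Σ_p Σ_{p'} 1[p' = π_M p]·ν(p,p')·x_p x_{p'}`. [folklore] -/
theorem edgeField_containment_eq (M : PMatch n) (U : OddSet n) (h : ℝ) (ν : Fin n → Fin n → ℝ) :
    ∑ p, (h * ν p (M.2.partner p)) * ((if p ∈ U.1 then (1 : ℝ) else 0) * (if M.2.partner p ∈ U.1 then (1 : ℝ) else 0)) =
      h * ∑ p, ∑ p', (if p' = M.2.partner p then (1 : ℝ) else 0) *
        (ν p p' * ((if p ∈ U.1 then (1 : ℝ) else 0) * (if p' ∈ U.1 then (1 : ℝ) else 0))) := by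
  rw [mul_sum]
  refine sum_congr rfl fun p _ => ?_
  rw [Finset.sum_eq_single (M.2.partner p)]
  · rw [if_pos rfl]; ring
  · intro p' _ hp'; rw [if_neg hp']; ring
  · intro hh; exact absurd (mem_univ _) hh

/-- The square: `(Σ_p h·ν(p,π_Mp)·x_px_{π_Mp})² = Σ_{p,p',q,q'} (h²·1[p'=π_Mp]·1[q'=π_Mq])·(ν(p,p')ν(q,q')·x_px_{p'}x_qx_{q'})`. [folklore] -/
theorem edgeField_containment_sq_eq (M : PMatch n) (U : OddSet n) (h : ℝ) (ν : Fin n → Fin n → ℝ) :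
    (∑ p, (h * ν p (M.2.partner p)) * ((if p ∈ U.1 then (1 : ℝ) else 0) * (if M.2.partner p ∈ U.1 then (1 : ℝ) else 0))) ^ 2 =
      ∑ p, ∑ p', ∑ q, ∑ q', (h ^ 2 * ((if p' = M.2.partner p then (1 : ℝ) else 0) * (if q' = M.2.partner q then (1 : ℝ) else 0))) *
        ((ν p p' * ν q q') * (((if p ∈ U.1 then (1 : ℝ) else 0) * (if p' ∈ U.1 then (1 : ℝ) else 0)) *
          ((if q ∈ U.1 then (1 : ℝ) else 0) * (if q' ∈ U.1 then (1 : ℝ) else 0)))) := by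
  -- each coordinate term as a sum over a free partner vertex
  have hc : ∀ p, (h * ν p (M.2.partner p)) * ((if p ∈ U.1 then (1 : ℝ) else 0) * (if M.2.partner p ∈ U.1 then (1 : ℝ) else 0)) =
      ∑ p', (h * (if p' = M.2.partner p then (1 : ℝ) else 0)) *
        (ν p p' * ((if p ∈ U.1 then (1 : ℝ) else 0) * (if p' ∈ U.1 then (1 : ℝ) else 0))) := by
    intro p
    rw [Finset.sum_eq_single (M.2.partner p)]
    · rw [if_pos rfl]; ring
    · intro p' _ hp'; rw [if_neg hp']; ring
    · intro hh; exact absurd (mem_univ _) hh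
  conv_lhs => rw [sq]
  rw [Finset.sum_mul_sum]
  refine sum_congr rfl fun p _ => ?_
  rw [sum_comm]
  refine sum_congr rfl fun q _ => ?_
  rw [hc p, hc q, Finset.sum_mul_sum]
  refine sum_congr rfl fun p' _ => sum_congr rfl fun q' _ => ?_
  ring

/-- **THE PER-CUT VALUE OF AN EDGE-TYPE FIELD IS A QUADRATIC FORM AGAINST THE PINNED-PARTNER DESIGN VALUES AT THE CUT**: for any weight `W`,
any cut `U`, any tilt `h` and pair weighting `ν`,
`Σ_M W(U,M)·(Σ_p h(M)ν(p,π_Mp) x_p x_{π_Mp})² = Σ_{p,p',q,q'} ν(p,p')ν(q,q')·x_px_{p'}x_qx_{q'}·(Σ_M W(U,M) h(M)² 1[π_Mp = p'] 1[π_Mq = q'])`.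
[cite: Rothvoss2017, §2 (PDF p. 6)] -/
theorem perCut_edgeField_eq_sum_pinned (W : OddSet n → PMatch n → ℝ) (U : OddSet n) (h : PMatch n → ℝ) (ν : Fin n → Fin n → ℝ) :
    ∑ M : PMatch n, W U M *
        (∑ p, (h M * ν p (M.2.partner p)) * ((if p ∈ U.1 then (1 : ℝ) else 0) * (if M.2.partner p ∈ U.1 then (1 : ℝ) else 0))) ^ 2 =
      ∑ p, ∑ p', ∑ q, ∑ q', (ν p p' * ν q q') *
        ((((if p ∈ U.1 then (1 : ℝ) else 0) * (if p' ∈ U.1 then (1 : ℝ) else 0)) *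
          ((if q ∈ U.1 then (1 : ℝ) else 0) * (if q' ∈ U.1 then (1 : ℝ) else 0))) *
          ∑ M : PMatch n, W U M * (h M ^ 2 *
            ((if p' = M.2.partner p then (1 : ℝ) else 0) * (if q' = M.2.partner q then (1 : ℝ) else 0)))) := by
  set x : OddSet n → Fin n → ℝ := fun U a => if a ∈ U.1 then (1 : ℝ) else 0 with hx
  change ∑ M : PMatch n, W U M * (∑ p, (h M * ν p (M.2.partner p)) * (x U p * x U (M.2.partner p))) ^ 2 =
    ∑ p, ∑ p', ∑ q, ∑ q', (ν p p' * ν q q') * (((x U p * x U p') * (x U q * x U q')) *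
      ∑ M : PMatch n, W U M * (h M ^ 2 * ((if p' = M.2.partner p then (1 : ℝ) else 0) * (if q' = M.2.partner q then (1 : ℝ) else 0))))
  have hM : ∀ M : PMatch n, W U M * (∑ p, (h M * ν p (M.2.partner p)) * (x U p * x U (M.2.partner p))) ^ 2 =
      ∑ p, ∑ p', ∑ q, ∑ q', (ν p p' * ν q q') * (((x U p * x U p') * (x U q * x U q')) *
        (W U M * (h M ^ 2 * ((if p' = M.2.partner p then (1 : ℝ) else 0) * (if q' = M.2.partner q then (1 : ℝ) else 0))))) := by
    intro M
    rw [edgeField_containment_sq_eq M U (h M) ν, mul_sum]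
    refine sum_congr rfl fun p _ => ?_
    rw [mul_sum]
    refine sum_congr rfl fun p' _ => ?_
    rw [mul_sum]
    refine sum_congr rfl fun q _ => ?_
    rw [mul_sum]
    refine sum_congr rfl fun q' _ => ?_
    ring
  rw [sum_congr rfl fun M _ => hM M, sum_comm]
  refine sum_congr rfl fun p _ => ?_
  rw [sum_comm]
  refine sum_congr rfl fun p' _ => ?_
  rw [sum_comm]
  refine sum_congr rfl fun q _ => ?_
  rw [sum_comm]
  refine sum_congr rfl fun q' _ => ?_
  rw [← mul_sum, ← mul_sum]

/-! ### §2 The per-cut pinned-partner values are virtually nonpositive entrywise, on average over cuts -/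

/-- **`Σ_U Σ_{p,p',q,q'} x_px_{p'}x_qx_{q'}·(R_U(p,p';q,q'))₊ ≤ n⁴·γ`** for any weight with all-rectangle bound `γ` and any `|h| ≤ 1`: each entry's
positive part over the cuts is the [0,1]-weighted rectangle (`x_px_{p'}x_qx_{q'}·1[R_U > 0]`) × (`h²·1[π_Mp = p']·1[π_Mq = q']`).
[cite: Rothvoss2017, §2 and Lemma 7 (PDF pp. 6–8)] [cite: Grigoriev2001, Lemma 1.4 (PDF p. 8)] -/
theorem sum_posPart_perCut_pinned_le (W : OddSet n → PMatch n → ℝ) {γ : ℝ}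
    (hR : ∀ (A : Finset (OddSet n)) (B : Finset (PMatch n)), ∑ U ∈ A, ∑ M ∈ B, W U M ≤ γ)
    (h : PMatch n → ℝ) (hh : ∀ M, |h M| ≤ 1) :
    ∑ U : OddSet n, ∑ p, ∑ p', ∑ q, ∑ q',
        (((if p ∈ U.1 then (1 : ℝ) else 0) * (if p' ∈ U.1 then (1 : ℝ) else 0)) *
          ((if q ∈ U.1 then (1 : ℝ) else 0) * (if q' ∈ U.1 then (1 : ℝ) else 0))) *
        max (∑ M : PMatch n, W U M * (h M ^ 2 *
          ((if p' = M.2.partner p then (1 : ℝ) else 0) * (if q' = M.2.partner q then (1 : ℝ) else 0)))) 0 ≤ (n : ℝ) ^ 4 * γ := by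
  set x : OddSet n → Fin n → ℝ := fun U a => if a ∈ U.1 then (1 : ℝ) else 0 with hx
  have hx01 : ∀ U a, 0 ≤ x U a ∧ x U a ≤ 1 := fun U a => by rw [hx]; dsimp only; split_ifs <;> norm_num
  set g : Fin n → Fin n → Fin n → Fin n → OddSet n → ℝ := fun p p' q q' U => (x U p * x U p') * (x U q * x U q') with hg
  have hg01 : ∀ p p' q q' U, 0 ≤ g p p' q q' U ∧ g p p' q q' U ≤ 1 := by
    intro p p' q q' U
    rw [hg]; dsimp only
    have h2 := hx01 U p; have h3 := hx01 U p'; have h4 := hx01 U q; have h5 := hx01 U q'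
    exact ⟨mul_nonneg (mul_nonneg h2.1 h3.1) (mul_nonneg h4.1 h5.1),
      mul_le_one₀ (mul_le_one₀ h2.2 h3.1 h3.2) (mul_nonneg h4.1 h5.1) (mul_le_one₀ h4.2 h5.1 h5.2)⟩
  set k : Fin n → Fin n → Fin n → Fin n → PMatch n → ℝ := fun p p' q q' M =>
    h M ^ 2 * ((if p' = M.2.partner p then (1 : ℝ) else 0) * (if q' = M.2.partner q then (1 : ℝ) else 0)) with hk
  have hh2 : ∀ M, 0 ≤ h M ^ 2 ∧ h M ^ 2 ≤ 1 := fun M => ⟨sq_nonneg _, (sq_le_one_iff_abs_le_one _).2 (hh M)⟩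
  have hk01 : ∀ p p' q q' M, 0 ≤ k p p' q q' M ∧ k p p' q q' M ≤ 1 := fun p p' q q' M => by
    rw [hk]; dsimp only
    have := hh2 M
    split_ifs <;> simp [this.1, this.2]
  -- `g ≥ 0` pulls out of the positive part
  have hpull : ∀ p p' q q' (U : OddSet n), g p p' q q' U * max (∑ M : PMatch n, W U M * k p p' q q' M) 0 =
      max (g p p' q q' U * ∑ M : PMatch n, W U M * k p p' q q' M) 0 := fun p p' q q' U => by
    rw [mul_max_of_nonneg _ _ (hg01 p p' q q' U).1, mul_zero]
  change ∑ U : OddSet n, ∑ p, ∑ p', ∑ q, ∑ q', g p p' q q' U * max (∑ M : PMatch n, W U M * k p p' q q' M) 0 ≤ (n : ℝ) ^ 4 * γ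
  calc ∑ U : OddSet n, ∑ p, ∑ p', ∑ q, ∑ q', g p p' q q' U * max (∑ M : PMatch n, W U M * k p p' q q' M) 0
      = ∑ p : Fin n, ∑ p' : Fin n, ∑ q : Fin n, ∑ q' : Fin n,
          ∑ U : OddSet n, max (g p p' q q' U * ∑ M : PMatch n, W U M * k p p' q q' M) 0 := by
        rw [sum_comm]
        refine sum_congr rfl fun p _ => ?_
        rw [sum_comm]
        refine sum_congr rfl fun p' _ => ?_
        rw [sum_comm]
        refine sum_congr rfl fun q _ => ?_
        rw [sum_comm]
        exact sum_congr rfl fun q' _ => sum_congr rfl fun U _ => hpull p p' q q' U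
    _ ≤ ∑ p : Fin n, ∑ p' : Fin n, ∑ q : Fin n, ∑ q' : Fin n, γ :=
        sum_le_sum fun p _ => sum_le_sum fun p' _ => sum_le_sum fun q _ => sum_le_sum fun q' _ =>
          sum_posPart_cut_mul_le_of_rectangles W hR (g p p' q q') (hg01 p p' q q') (k p p' q q') (hk01 p p' q q')
    _ = (n : ℝ) ^ 4 * γ := by
        simp only [sum_const, card_univ, Fintype.card_fin, nsmul_eq_mul]
        ring

/-! ### §3 (PC) on edge-type fields is cube-positivity of the entrywise negative part of the pinned-partner values, per cut -/

/-- **REDUCTION TO THE NEGATIVE PART, per cut.** For `|ν| ≤ 1`: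
`|Σ_M W(U,M) C_{h·ν∘π_M}(U)² − Σ_{p,p',q,q'} ν(p,p')ν(q,q')·x⁴·min(R_U,0)| ≤ Σ_{p,p',q,q'} x⁴·(R_U)₊`. [folklore] -/
theorem perCut_edgeField_sub_negPart_abs_le (W : OddSet n → PMatch n → ℝ) (U : OddSet n) (h : PMatch n → ℝ)
    (ν : Fin n → Fin n → ℝ) (hν : ∀ p p', |ν p p'| ≤ 1) :
    |∑ M : PMatch n, W U M *
          (∑ p, (h M * ν p (M.2.partner p)) * ((if p ∈ U.1 then (1 : ℝ) else 0) * (if M.2.partner p ∈ U.1 then (1 : ℝ) else 0))) ^ 2 -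
        ∑ p, ∑ p', ∑ q, ∑ q', (ν p p' * ν q q') *
          ((((if p ∈ U.1 then (1 : ℝ) else 0) * (if p' ∈ U.1 then (1 : ℝ) else 0)) *
            ((if q ∈ U.1 then (1 : ℝ) else 0) * (if q' ∈ U.1 then (1 : ℝ) else 0))) *
            min (∑ M : PMatch n, W U M * (h M ^ 2 *
              ((if p' = M.2.partner p then (1 : ℝ) else 0) * (if q' = M.2.partner q then (1 : ℝ) else 0)))) 0)| ≤
      ∑ p, ∑ p', ∑ q, ∑ q',
        (((if p ∈ U.1 then (1 : ℝ) else 0) * (if p' ∈ U.1 then (1 : ℝ) else 0)) *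
          ((if q ∈ U.1 then (1 : ℝ) else 0) * (if q' ∈ U.1 then (1 : ℝ) else 0))) *
        max (∑ M : PMatch n, W U M * (h M ^ 2 *
          ((if p' = M.2.partner p then (1 : ℝ) else 0) * (if q' = M.2.partner q then (1 : ℝ) else 0)))) 0 := by
  set x : OddSet n → Fin n → ℝ := fun U a => if a ∈ U.1 then (1 : ℝ) else 0 with hx
  have hx01 : ∀ a, 0 ≤ x U a ∧ x U a ≤ 1 := fun a => by rw [hx]; dsimp only; split_ifs <;> norm_num
  set R : Fin n → Fin n → Fin n → Fin n → ℝ := fun p p' q q' =>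
    ∑ M : PMatch n, W U M * (h M ^ 2 * ((if p' = M.2.partner p then (1 : ℝ) else 0) * (if q' = M.2.partner q then (1 : ℝ) else 0)))
    with hRdef
  set G : Fin n → Fin n → Fin n → Fin n → ℝ := fun p p' q q' => (x U p * x U p') * (x U q * x U q') with hG
  have hG0 : ∀ p p' q q', 0 ≤ G p p' q q' := fun p p' q q' => by
    rw [hG]; dsimp only
    exact mul_nonneg (mul_nonneg (hx01 p).1 (hx01 p').1) (mul_nonneg (hx01 q).1 (hx01 q').1)
  have hid : ∑ M : PMatch n, W U M * (∑ p, (h M * ν p (M.2.partner p)) * (x U p * x U (M.2.partner p))) ^ 2 =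
      ∑ p, ∑ p', ∑ q, ∑ q', (ν p p' * ν q q') * (G p p' q q' * R p p' q q') := perCut_edgeField_eq_sum_pinned W U h ν
  change |∑ M : PMatch n, W U M * (∑ p, (h M * ν p (M.2.partner p)) * (x U p * x U (M.2.partner p))) ^ 2 -
      ∑ p, ∑ p', ∑ q, ∑ q', (ν p p' * ν q q') * (G p p' q q' * min (R p p' q q') 0)| ≤
    ∑ p, ∑ p', ∑ q, ∑ q', G p p' q q' * max (R p p' q q') 0
  rw [hid]
  have hsplit : ∑ p, ∑ p', ∑ q, ∑ q', (ν p p' * ν q q') * (G p p' q q' * R p p' q q') -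
      ∑ p, ∑ p', ∑ q, ∑ q', (ν p p' * ν q q') * (G p p' q q' * min (R p p' q q') 0) =
      ∑ p, ∑ p', ∑ q, ∑ q', (ν p p' * ν q q') * (G p p' q q' * max (R p p' q q') 0) := by
    rw [← sum_sub_distrib]
    refine sum_congr rfl fun p _ => ?_
    rw [← sum_sub_distrib]
    refine sum_congr rfl fun p' _ => ?_
    rw [← sum_sub_distrib]
    refine sum_congr rfl fun q _ => ?_
    rw [← sum_sub_distrib]
    refine sum_congr rfl fun q' _ => ?_
    have : R p p' q q' = min (R p p' q q') 0 + max (R p p' q q') 0 := by rw [min_add_max, add_zero]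
    linear_combination (ν p p' * ν q q') * G p p' q q' * this
  rw [hsplit]
  refine (abs_sum_le_sum_abs _ _).trans (sum_le_sum fun p _ => (abs_sum_le_sum_abs _ _).trans (sum_le_sum fun p' _ =>
    (abs_sum_le_sum_abs _ _).trans (sum_le_sum fun q _ => (abs_sum_le_sum_abs _ _).trans (sum_le_sum fun q' _ => ?_))))
  rw [abs_mul, abs_of_nonneg (mul_nonneg (hG0 p p' q q') (le_max_right _ _))]
  have hvv : |ν p p' * ν q q'| ≤ 1 := by rw [abs_mul]; exact mul_le_one₀ (hν p p') (abs_nonneg _) (hν q q')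
  calc |ν p p' * ν q q'| * (G p p' q q' * max (R p p' q q') 0) ≤ 1 * (G p p' q q' * max (R p p' q q') 0) :=
        mul_le_mul_of_nonneg_right hvv (mul_nonneg (hG0 p p' q q') (le_max_right _ _))
    _ = G p p' q q' * max (R p p' q q') 0 := one_mul _

/-- **Summed over cuts** (any `W` with all-rectangle bound `γ`, `|h| ≤ 1`, `|ν| ≤ 1`):
`Σ_U |Σ_M W C_{h·ν∘π}² − Σ νν·x⁴·min(R_U,0)| ≤ n⁴·γ`. [cite: Rothvoss2017, §2 and Lemma 7 (PDF pp. 6–8)] [cite: Grigoriev2001, Lemma 1.4 (PDF p. 8)] -/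
theorem sum_perCut_edgeField_sub_negPart_abs_le (W : OddSet n → PMatch n → ℝ) {γ : ℝ}
    (hR : ∀ (A : Finset (OddSet n)) (B : Finset (PMatch n)), ∑ U ∈ A, ∑ M ∈ B, W U M ≤ γ)
    (h : PMatch n → ℝ) (hh : ∀ M, |h M| ≤ 1) (ν : Fin n → Fin n → ℝ) (hν : ∀ p p', |ν p p'| ≤ 1) :
    ∑ U : OddSet n, |∑ M : PMatch n, W U M *
          (∑ p, (h M * ν p (M.2.partner p)) * ((if p ∈ U.1 then (1 : ℝ) else 0) * (if M.2.partner p ∈ U.1 then (1 : ℝ) else 0))) ^ 2 -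
        ∑ p, ∑ p', ∑ q, ∑ q', (ν p p' * ν q q') *
          ((((if p ∈ U.1 then (1 : ℝ) else 0) * (if p' ∈ U.1 then (1 : ℝ) else 0)) *
            ((if q ∈ U.1 then (1 : ℝ) else 0) * (if q' ∈ U.1 then (1 : ℝ) else 0))) *
            min (∑ M : PMatch n, W U M * (h M ^ 2 *
              ((if p' = M.2.partner p then (1 : ℝ) else 0) * (if q' = M.2.partner q then (1 : ℝ) else 0)))) 0)| ≤
      (n : ℝ) ^ 4 * γ :=
  (sum_le_sum fun U _ => perCut_edgeField_sub_negPart_abs_le W U h ν hν).trans (sum_posPart_perCut_pinned_le W hR h hh)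

/-- **(PC) on the edge-type field FROM cube-positivity of the negative part**:
`Σ_U (Σ_M W C_{h·ν∘π}²)₊ ≤ Σ_U (Σ_{p,p',q,q'} ν(p,p')ν(q,q')·x⁴·min(R_U,0))₊ + n⁴γ`. [cite: Rothvoss2017, §2 and Lemma 7 (PDF pp. 6–8)]
[cite: Grigoriev2001, Lemma 1.4 (PDF p. 8)] -/
theorem sum_posPart_perCut_edgeField_le_negPart (W : OddSet n → PMatch n → ℝ) {γ : ℝ}
    (hR : ∀ (A : Finset (OddSet n)) (B : Finset (PMatch n)), ∑ U ∈ A, ∑ M ∈ B, W U M ≤ γ)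
    (h : PMatch n → ℝ) (hh : ∀ M, |h M| ≤ 1) (ν : Fin n → Fin n → ℝ) (hν : ∀ p p', |ν p p'| ≤ 1) :
    ∑ U : OddSet n, max (∑ M : PMatch n, W U M *
        (∑ p, (h M * ν p (M.2.partner p)) * ((if p ∈ U.1 then (1 : ℝ) else 0) * (if M.2.partner p ∈ U.1 then (1 : ℝ) else 0))) ^ 2) 0 ≤
      ∑ U : OddSet n, max (∑ p, ∑ p', ∑ q, ∑ q', (ν p p' * ν q q') *
          ((((if p ∈ U.1 then (1 : ℝ) else 0) * (if p' ∈ U.1 then (1 : ℝ) else 0)) *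
            ((if q ∈ U.1 then (1 : ℝ) else 0) * (if q' ∈ U.1 then (1 : ℝ) else 0))) *
            min (∑ M : PMatch n, W U M * (h M ^ 2 *
              ((if p' = M.2.partner p then (1 : ℝ) else 0) * (if q' = M.2.partner q then (1 : ℝ) else 0)))) 0)) 0 +
        (n : ℝ) ^ 4 * γ := by
  set x : OddSet n → Fin n → ℝ := fun U a => if a ∈ U.1 then (1 : ℝ) else 0 with hx
  set Q : OddSet n → ℝ := fun U => ∑ M : PMatch n, W U M *
    (∑ p, (h M * ν p (M.2.partner p)) * (x U p * x U (M.2.partner p))) ^ 2 with hQ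
  set N : OddSet n → ℝ := fun U => ∑ p, ∑ p', ∑ q, ∑ q', (ν p p' * ν q q') * (((x U p * x U p') * (x U q * x U q')) *
    min (∑ M : PMatch n, W U M * (h M ^ 2 *
      ((if p' = M.2.partner p then (1 : ℝ) else 0) * (if q' = M.2.partner q then (1 : ℝ) else 0)))) 0) with hN
  have hsum : ∑ U : OddSet n, |Q U - N U| ≤ (n : ℝ) ^ 4 * γ := sum_perCut_edgeField_sub_negPart_abs_le W hR h hh ν hν
  change ∑ U : OddSet n, max (Q U) 0 ≤ ∑ U : OddSet n, max (N U) 0 + (n : ℝ) ^ 4 * γ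
  calc ∑ U : OddSet n, max (Q U) 0 ≤ ∑ U : OddSet n, (max (N U) 0 + |Q U - N U|) :=
        sum_le_sum fun U _ => posPart_le_posPart_add_abs (Q U) (N U)
    _ = ∑ U : OddSet n, max (N U) 0 + ∑ U : OddSet n, |Q U - N U| := sum_add_distrib
    _ ≤ ∑ U : OddSet n, max (N U) 0 + (n : ℝ) ^ 4 * γ := add_le_add le_rfl hsum

/-- **… and conversely**: `Σ_U (Σ νν·x⁴·min(R_U,0))₊ ≤ Σ_U (Σ_M W C_{h·ν∘π}²)₊ + n⁴γ` — the two per-cut statements are EQUIVALENT up to `n⁴γ`.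
[cite: Rothvoss2017, §2 and Lemma 7 (PDF pp. 6–8)] [cite: Grigoriev2001, Lemma 1.4 (PDF p. 8)] -/
theorem sum_posPart_negPart_le_perCut_edgeField (W : OddSet n → PMatch n → ℝ) {γ : ℝ}
    (hR : ∀ (A : Finset (OddSet n)) (B : Finset (PMatch n)), ∑ U ∈ A, ∑ M ∈ B, W U M ≤ γ)
    (h : PMatch n → ℝ) (hh : ∀ M, |h M| ≤ 1) (ν : Fin n → Fin n → ℝ) (hν : ∀ p p', |ν p p'| ≤ 1) :
    ∑ U : OddSet n, max (∑ p, ∑ p', ∑ q, ∑ q', (ν p p' * ν q q') *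
          ((((if p ∈ U.1 then (1 : ℝ) else 0) * (if p' ∈ U.1 then (1 : ℝ) else 0)) *
            ((if q ∈ U.1 then (1 : ℝ) else 0) * (if q' ∈ U.1 then (1 : ℝ) else 0))) *
            min (∑ M : PMatch n, W U M * (h M ^ 2 *
              ((if p' = M.2.partner p then (1 : ℝ) else 0) * (if q' = M.2.partner q then (1 : ℝ) else 0)))) 0)) 0 ≤
      ∑ U : OddSet n, max (∑ M : PMatch n, W U M *
        (∑ p, (h M * ν p (M.2.partner p)) * ((if p ∈ U.1 then (1 : ℝ) else 0) * (if M.2.partner p ∈ U.1 then (1 : ℝ) else 0))) ^ 2) 0 +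
        (n : ℝ) ^ 4 * γ := by
  set x : OddSet n → Fin n → ℝ := fun U a => if a ∈ U.1 then (1 : ℝ) else 0 with hx
  set Q : OddSet n → ℝ := fun U => ∑ M : PMatch n, W U M *
    (∑ p, (h M * ν p (M.2.partner p)) * (x U p * x U (M.2.partner p))) ^ 2 with hQ
  set N : OddSet n → ℝ := fun U => ∑ p, ∑ p', ∑ q, ∑ q', (ν p p' * ν q q') * (((x U p * x U p') * (x U q * x U q')) *
    min (∑ M : PMatch n, W U M * (h M ^ 2 *
      ((if p' = M.2.partner p then (1 : ℝ) else 0) * (if q' = M.2.partner q then (1 : ℝ) else 0)))) 0) with hN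
  have hsum : ∑ U : OddSet n, |Q U - N U| ≤ (n : ℝ) ^ 4 * γ := sum_perCut_edgeField_sub_negPart_abs_le W hR h hh ν hν
  change ∑ U : OddSet n, max (N U) 0 ≤ ∑ U : OddSet n, max (Q U) 0 + (n : ℝ) ^ 4 * γ
  calc ∑ U : OddSet n, max (N U) 0 ≤ ∑ U : OddSet n, (max (Q U) 0 + |N U - Q U|) :=
        sum_le_sum fun U _ => posPart_le_posPart_add_abs (N U) (Q U)
    _ = ∑ U : OddSet n, max (Q U) 0 + ∑ U : OddSet n, |Q U - N U| := by
        rw [sum_add_distrib]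
        exact congrArg _ (sum_congr rfl fun U _ => abs_sub_comm _ _)
    _ ≤ ∑ U : OddSet n, max (Q U) 0 + (n : ℝ) ^ 4 * γ := add_le_add le_rfl hsum

/-! ### §4 Design corollaries (unconditional, via the `r = 1` rung for all rectangles) -/

/-- **Per-cut pinned-partner design values of balanced Chebyshev designs are virtually nonpositive entrywise — UNCONDITIONAL**
(`γ = 20·e^{−a·dq n}`). [cite: Rothvoss2017, §2 and Lemma 7 (PDF pp. 6–8)] [cite: KeevashLifshitz2023, Thm. 1.8] -/
theorem perCut_pinned_posPart_decay :
    ∃ a : ℝ, 0 < a ∧ ∃ n₁ : ℕ, ∀ n : ℕ, n₁ ≤ n → Even n → ∀ (t : ℕ) (C : Finset ℕ) (w : ℕ → ℝ),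
      IsBalancedDesign n t (Tq n) (dq n) 20 C w → ∀ (h : PMatch n → ℝ), (∀ M, |h M| ≤ 1) →
        ∑ U : OddSet n, ∑ p, ∑ p', ∑ q, ∑ q',
          (((if p ∈ U.1 then (1 : ℝ) else 0) * (if p' ∈ U.1 then (1 : ℝ) else 0)) *
            ((if q ∈ U.1 then (1 : ℝ) else 0) * (if q' ∈ U.1 then (1 : ℝ) else 0))) *
          max (∑ M : PMatch n, levelWeight n t C w U M * (h M ^ 2 *
            ((if p' = M.2.partner p then (1 : ℝ) else 0) * (if q' = M.2.partner q then (1 : ℝ) else 0)))) 0 ≤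
        (n : ℝ) ^ 4 * (20 * Real.exp (-(a * (dq n : ℝ)))) := by
  obtain ⟨a, ha, n₁, hrung⟩ := rectangleDecayExp_all_holds
  exact ⟨a, ha, n₁, fun n hn hev t C w hdes h hh => sum_posPart_perCut_pinned_le _ (hrung n hn hev t C w hdes) h hh⟩

/-- **(PC) ON EDGE-TYPE FIELDS REDUCES TO CUBE-POSITIVITY OF THE VIRTUAL PINNED-PARTNER DENSITIES AT THE CUT — UNCONDITIONAL form for the
crux's designs**: for some `a > 0` and all large even `n`, every balanced exact design of degree `dq n` with `Σ|w| ≤ 20`, every tilt `|h| ≤ 1` and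
pair weighting `|ν| ≤ 1`:
`Σ_U (Σ_M W C_{h·ν∘π_M}(U)²)₊ ≤ Σ_U (Σ_{p,p',q,q'} ν(p,p')ν(q,q')·x⁴·min(R_U,0))₊ + 20·n⁴·e^{−a·dq n}`.
[cite: Rothvoss2017, §2 and Lemma 7 (PDF pp. 6–8)] [cite: KeevashLifshitz2023, Thm. 1.8] [cite: GriblingDelaatLaurent2019, §5] -/
theorem perCut_edgeField_negPart_reduction :
    ∃ a : ℝ, 0 < a ∧ ∃ n₁ : ℕ, ∀ n : ℕ, n₁ ≤ n → Even n → ∀ (t : ℕ) (C : Finset ℕ) (w : ℕ → ℝ),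
      IsBalancedDesign n t (Tq n) (dq n) 20 C w → ∀ (h : PMatch n → ℝ), (∀ M, |h M| ≤ 1) →
        ∀ (ν : Fin n → Fin n → ℝ), (∀ p p', |ν p p'| ≤ 1) →
        ∑ U : OddSet n, max (∑ M : PMatch n, levelWeight n t C w U M *
          (∑ p, (h M * ν p (M.2.partner p)) * ((if p ∈ U.1 then (1 : ℝ) else 0) * (if M.2.partner p ∈ U.1 then (1 : ℝ) else 0))) ^ 2) 0 ≤
        ∑ U : OddSet n, max (∑ p, ∑ p', ∑ q, ∑ q', (ν p p' * ν q q') *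
            ((((if p ∈ U.1 then (1 : ℝ) else 0) * (if p' ∈ U.1 then (1 : ℝ) else 0)) *
              ((if q ∈ U.1 then (1 : ℝ) else 0) * (if q' ∈ U.1 then (1 : ℝ) else 0))) *
              min (∑ M : PMatch n, levelWeight n t C w U M * (h M ^ 2 *
                ((if p' = M.2.partner p then (1 : ℝ) else 0) * (if q' = M.2.partner q then (1 : ℝ) else 0)))) 0)) 0 +
          (n : ℝ) ^ 4 * (20 * Real.exp (-(a * (dq n : ℝ)))) := by
  obtain ⟨a, ha, n₁, hrung⟩ := rectangleDecayExp_all_holds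
  exact ⟨a, ha, n₁, fun n hn hev t C w hdes h hh ν hν =>
    sum_posPart_perCut_edgeField_le_negPart _ (hrung n hn hev t C w hdes) h hh ν hν⟩

end Summit.PneNP.PneNP.Theorems.ChebyshevTracialDesignPerCutPinnedPartners
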